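import Summits.NavierStokesRegularity.FunctionalMining.HsChessboardHigh
import HarnessLib

/-!
# FunctionalMining — Gibbon's chessboard on `T³`, one statement for every square `(n, m)`,
# `n ≥ 1`, `1 ≤ m < ∞`: `∫₀ᵀ ‖∇ⁿu‖_{2m}^{α_{n,m}} dt ≤ K(1+T)`, `α_{n,m} = 2m/(2m(n+1)−3)`

Search for candidate a priori estimates; no regularity claim. Cell `pub-nsfunc`, lit seat (gen 16);
the single citation point for CRITERIA §B row B4 (Gibbon, J. Nonlinear Sci. 29 (2019) 215–228, Thm 1,
Table 1: "all the known time-averaged estimates for weak solutions can be rolled into one single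
estimate" `⟨‖∇ⁿu‖_{2m}^{α_{n,m}}⟩_T < ∞`). The cases are the files `HsTimeAverages` (`m = 1`,
Foias–Guillopé–Temam 1981 at every real order), `HsChessboardLow` (`1 < m ≤ 3`) and `HsChessboardHigh`
(`3 < m < ∞`; the row `m = ∞` is there in Agmon-majorant form, `HsChessboard.chessboard_top`):

* `HsChessboard.chessboard` — for every `n ≥ 1`, every real `m ≥ 1`, `ν > 0`, `M ≥ 0` there is
  `K = K(n, m, ν, M) ≥ 0` such that along every classical zero-mean solution of the unforced
  Navier–Stokes equations on `[0, T] × T³`, `T > 0`, with `‖u(0)‖₂² ≤ M`,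
  `∫₀ᵀ (∫ |∇ⁿu(t)|^{2m} dx)^{1/(2m(n+1)−3)} dt ≤ K (1 + T)`,
  `|∇ⁿu(t,x)|² = ∑_{w : Fin n → Fin 3} ‖∂^w u(t,x)‖²` (i.e. `⟨‖∇ⁿu‖_{2m}^{α_{n,m}}⟩_T ≤ K(1+T)/T`).

Faithfulness: classical instead of Leray–Hopf solutions, `f = 0`, constant existential in the printed
dependence (print: `c_{n,m}L⁻¹ν^{α_{n,m}}Re³ + O(T⁻¹)`). Energy-class a priori bounds; they assert neither
regularity nor blow-up.

## References

* [Gibbon2019Chessboard] J. D. Gibbon, J. Nonlinear Sci. 29 (2019) 215–228, Thm 1 / Table 1, Thm 2,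
  Appendix A (held: arXiv:1803.11518 pp. 4–7).
* [FoiasGuillopeTemam1981] Comm. PDE 6 (1981) 329–359, Thm 3.1 (column `m = 1`).
-/

noncomputable section

open MeasureTheory Set Filter Topology Function Real intervalIntegral Finset UnitAddTorus
open scoped InnerProductSpace RealInnerProductSpace ENNReal BigOperators

namespace Summit.NavierStokesRegularity.FunctionalMining

open Literature.Analysis Literature.Analysis.FunctionSpaces Literature.Analysis.FluidPDE
open Literature.Analysis.FunctionSpaces.Torus Literature.Analysis.FluidPDE.Torus

namespace HsChessboard

/-- **Gibbon's chessboard on `T³`, every square `(n, m)` with `n ≥ 1`, `1 ≤ m < ∞`** (classical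
zero-mean solutions of unforced Navier–Stokes on `[0, T] × T³` with `‖u(0)‖₂² ≤ M`): there is
`K = K(n, m, ν, M) ≥ 0` with `∫₀ᵀ (∫ (∑_w ‖∂^w u(t)‖²)^m dx)^{1/(2m(n+1)−3)} dt ≤ K(1+T)`, i.e.
`∫₀ᵀ ‖∇ⁿu‖_{2m}^{α_{n,m}} ≤ K(1+T)`, `α_{n,m} = 2m/(2m(n+1)−3)` — `m = 1`: Foias–Guillopé–Temam
(`HsTimeAverages.timeAverage_le`, `∫|∇ⁿu|² = E_n`); `1 < m < 3`: `chessboard_low`; `m = 3`: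
`chessboard_three`; `3 < m`: `chessboard_high`. The row `m = ∞` is `chessboard_top` (majorant form).
[cite: Gibbon2019Chessboard, Thm 1 / Table 1 (n ≥ 1, 1 ≤ m < ∞)] [cite: FoiasGuillopeTemam1981, Thm 3.1]
(classical solutions; ours) -/
theorem chessboard {n : ℕ} (hn : 1 ≤ n) {m : ℝ} (hm : 1 ≤ m) {ν M : ℝ} (hν : 0 < ν) (hM : 0 ≤ M) :
    ∃ K : ℝ, 0 ≤ K ∧ ∀ {T : ℝ}, 0 < T →
      ∀ {u : ℝ → UnitAddTorus (Fin 3) → EuclideanSpace ℝ (Fin 3)} {p : ℝ → UnitAddTorus (Fin 3) → ℝ},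
      IsClassicalNSSolutionOn (Icc 0 T) ν 0 u p → (∀ t ∈ Icc 0 T, HasZeroMean (u t)) →
        ∫ x, ‖u 0 x‖ ^ 2 ≤ M →
          ∫ t in (0 : ℝ)..T, (∫ x, (∑ w : Fin n → Fin 3, ‖wordDeriv (List.ofFn w) (u t) x‖ ^ 2) ^ m) ^
              (2 * m * ((n : ℝ) + 1) - 3)⁻¹ ≤ K * (1 + T) := by
  have hn1 : (1 : ℝ) ≤ n := by exact_mod_cast hn
  rcases eq_or_lt_of_le hm with h1 | h1
  · -- `m = 1`: `∫ |∇ⁿu|² = E_n`, exponent `1/(2n−1)`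
    subst h1
    obtain ⟨K, hK0, hK⟩ := HsTimeAverages.timeAverage_le (s := (n : ℝ)) hn1 hν hM
    refine ⟨K, hK0, fun {T} hT u p h hmean hu0 => ?_⟩
    have e : ∫ t in (0 : ℝ)..T, (∫ x, (∑ w : Fin n → Fin 3, ‖wordDeriv (List.ofFn w) (u t) x‖ ^ 2) ^ (1 : ℝ)) ^
        (2 * (1 : ℝ) * ((n : ℝ) + 1) - 3)⁻¹ =
        ∫ t in (0 : ℝ)..T, torusHsEnergy (n : ℝ) (u t) ^ (2 * (n : ℝ) - 1)⁻¹ := by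
      refine intervalIntegral.integral_congr fun t ht => ?_
      have ht' : t ∈ Icc 0 T := by rwa [uIcc_of_le hT.le] at ht
      have hut : IsSmooth (u t) := h.smooth_velocity.isSmooth_slice ht'
      have hwc : ∀ w : Fin n → Fin 3, Continuous fun x => wordDeriv (List.ofFn w) (u t) x :=
        fun w => (isSmooth_wordDeriv hut _).continuous
      show (∫ x, (∑ w : Fin n → Fin 3, ‖wordDeriv (List.ofFn w) (u t) x‖ ^ 2) ^ (1 : ℝ)) ^
          (2 * (1 : ℝ) * ((n : ℝ) + 1) - 3)⁻¹ = torusHsEnergy (n : ℝ) (u t) ^ (2 * (n : ℝ) - 1)⁻¹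
      simp_rw [Real.rpow_one]
      rw [integral_finsetSum Finset.univ (f := fun w x => ‖wordDeriv (List.ofFn w) (u t) x‖ ^ 2)
        fun w _ => (((hwc w).norm).pow 2).integrable_unitAddTorus]
      have hW := HsWordEnergy.wordEnergy_eq_torusHsEnergy n hut
      rw [Torus.wordEnergy] at hW
      rw [hW, show 2 * (1 : ℝ) * ((n : ℝ) + 1) - 3 = 2 * (n : ℝ) - 1 by ring]
    rw [e]
    exact hK hT h hmean hu0
  rcases lt_trichotomy m 3 with h3 | h3 | h3
  · exact chessboard_low hn h1 h3 hν hM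
  · -- `m = 3`
    subst h3
    obtain ⟨K, hK0, hK⟩ := chessboard_three n hν hM
    refine ⟨K, hK0, fun {T} hT u p h hmean hu0 => ?_⟩
    have e : ∫ t in (0 : ℝ)..T, (∫ x, (∑ w : Fin n → Fin 3, ‖wordDeriv (List.ofFn w) (u t) x‖ ^ 2) ^ (3 : ℝ)) ^
        (2 * (3 : ℝ) * ((n : ℝ) + 1) - 3)⁻¹ =
        ∫ t in (0 : ℝ)..T, (∫ x, (∑ w : Fin n → Fin 3, ‖wordDeriv (List.ofFn w) (u t) x‖ ^ 2) ^ 3) ^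
          (6 * (n : ℝ) + 3)⁻¹ := by
      refine intervalIntegral.integral_congr fun t _ => ?_
      show (∫ x, (∑ w : Fin n → Fin 3, ‖wordDeriv (List.ofFn w) (u t) x‖ ^ 2) ^ (3 : ℝ)) ^
          (2 * (3 : ℝ) * ((n : ℝ) + 1) - 3)⁻¹ =
        (∫ x, (∑ w : Fin n → Fin 3, ‖wordDeriv (List.ofFn w) (u t) x‖ ^ 2) ^ 3) ^ (6 * (n : ℝ) + 3)⁻¹
      have e3 : ∫ x, (∑ w : Fin n → Fin 3, ‖wordDeriv (List.ofFn w) (u t) x‖ ^ 2) ^ (3 : ℝ) =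
          ∫ x, (∑ w : Fin n → Fin 3, ‖wordDeriv (List.ofFn w) (u t) x‖ ^ 2) ^ 3 :=
        integral_congr_ae (ae_of_all _ fun x => by norm_cast)
      rw [e3, show 2 * (3 : ℝ) * ((n : ℝ) + 1) - 3 = 6 * (n : ℝ) + 3 by ring]
    rw [e]
    exact hK hT h hmean hu0
  · exact chessboard_high n h3 hν hM

end HsChessboard

end Summit.NavierStokesRegularity.FunctionalMining
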